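import Literature.AlgebraicGeometry.Motives.SeesawRelativeChartSections
import Literature.AlgebraicGeometry.Motives.SeesawChartFibreCyclic
import Literature.AlgebraicGeometry.Modules.Biduality
import Literature.AlgebraicGeometry.Modules.DualSectionsEquiv
import Literature.AlgebraicGeometry.Modules.LineBundleUnitPairing
import Literature.AlgebraicGeometry.Modules.AffineLocalizingClosure
import Literature.AlgebraicGeometry.Modules.QuasicoherentAbelian
import HarnessLib

/-!
# RELATIVE EDITION (ring base `R`) — The seesaw closed subscheme, chart step: the fibres — sections over a field form a line, the empty fibre, base change of the pairing

RELATIVE EDITION of ★ `Motives/SeesawChartFibreCyclic` (port map `B-provers/B-p08/g11/PORTMAP-h8-RelativeSeesaw.B-p08g11.md`, file R3;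
cell `hodgecm-mathlib`, F-DAG §5b hand (h8), author B-p08 (g11)): `SchemeOver ℂ ↦ SchemeOver R`, Stein as the hypothesis
`hSt : UnivStein X` (★ `SeesawRelativeChartSections`); the base-free bricks of the ★ file (§1 empty schemes, §3 the linear algebra
of a functional without isotropic sections, the `FBIso`/`pullbackDualIso` cancellations) are IMPORTED from ★ `SeesawChartFibreCyclic`,
only the `X`-dependent statements are re-typed (namespace `Literature.AlgebraicGeometry.Motives.SeesawRelative`).  HC_CM is proved only
modulo the 7 printed citations until rung 0 closes.  Original module docstring (with `ℂ` read as `R`):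


[MumfordAV1970] §10 (p. 89), the three per-chart inputs of the seesaw theorem in scheme form ([GortzWedhorn2023] Thm. 24.66)
that concern single test algebras, in the vocabulary of `SeesawChartSections` (`X/ℂ` proper geometrically integral,
`𝓕` of rank one on `X × W`, affine `U ⊆ W`):
* §1–§2 (author B-p04 (g15), HOME `N1s-TrivOfSubsingleton.v1` a511f1ef): modules on a scheme WITHOUT POINTS are all isomorphic;
  for the zero ring `B`, `X × Spec B = ∅`, so `𝓕_B` is trivialised from the base (`trivOfSubsingleton`);
* §3–§4 (author B-p04 (g15), HOME `N1s-FibreDimLeOne.v2` 75ae2977): a functional killing no non-zero section makes the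
  sections a LINE over the constants (`finrank_eq_one_of_forall_ne_zero`, generic); on the integral proper fibre
  `X × Spec K` (`K` a field) a non-zero section and a non-zero functional pair to a non-zero constant
  (★ `appLE_ne_zero_of_ne_zero`, Hartshorne II 6.15), so `H⁰(X_K, 𝓕_K)` and `Hom(𝓕_K|_⊤, 𝒪|_⊤)` are lines as soon as
  the other side is non-zero (`h0_cyclic_of_dualSec_ne_zero`, `dualSec_cyclic_of_h0_ne_zero`);
* §5 (author B-p04 (g15), HOME `N1h-BrickNHolds.v1` cd1c15d2, over B-typ03 (g12)'s ★ `Modules.DualSectionsEquiv`):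
  **`evalPair_baseChange`** — the evaluation pairing commutes with base change, `μ_C(σ_C) = (1 × Spec φ)♯(μ_B(σ_B))`
  ([Hartshorne1977] II Ex. 5.1 (d)).
Decls token-identical to the HOME bytes except that the hypothesis `brickB` is discharged by the ★ name
(cell `hodgecm-mathlib`, M13 node N1, file S4b of the split plan; PROOF lane).

## References
* [MumfordAV1970] D. Mumford, *Abelian Varieties* (1970), §10 p. 89.
* [Hartshorne1977] R. Hartshorne, *Algebraic Geometry* (1977), II Prop. 6.15, II Ex. 5.1 (b), (d).
* [GortzWedhorn2020] U. Görtz, T. Wedhorn, *Algebraic Geometry I* (2020), Prop. 5.51.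
* [GortzWedhorn2023] U. Görtz, T. Wedhorn, *Algebraic Geometry II* (2023), Thm. 24.66 (p. 405; proof pp. 407–408).
-/

set_option autoImplicit false

noncomputable section

-- `TopCat.Presheaf`/`Scheme.Modules` are not reducible (as in Mathlib's `AlgebraicGeometry/Modules`).
set_option backward.isDefEq.respectTransparency false

universe u v

open CategoryTheory CategoryTheory.Limits AlgebraicGeometry MonoidalCategory CartesianMonoidalCategory
  Opposite TopologicalSpace



namespace Literature.AlgebraicGeometry.Motives

namespace SeesawRelative

open Literature.AlgebraicGeometry.Modules

variable {R : Type} [CommRing R] (X : SchemeOver R) {W : SchemeOver R} (𝓕 : (X ⊗ W).left.Modules)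
  (U : W.left.affineOpens)

/-! ## §2 The zero ring: `X × Spec 0 = ∅` is trivialised from the base -/

/-- **`X × Spec B` has no points for the zero ring `B`.** [cite: MumfordAV1970, §10 (p. 89)] -/
theorem isEmpty_tensor_specTest (B : Type) [CommRing B] [Algebra Γ(W.left, U) B] [Subsingleton B] :
    IsEmpty (X ⊗ SeesawRelative.specTest U B).left :=
  haveI : IsEmpty (specTest U B).left := Scheme.isEmpty_Spec_of_subsingleton B
  Scheme.isEmpty_of_hom (CartesianMonoidalCategory.snd X (specTest U B)).left

/-- **The zero ring** (half-empty charts of the seesaw locus): for the zero ring `B`,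
`𝓕_B` is trivialised from the base — `X × Spec B = ∅`, so `𝓕_B ≅ pr^*𝒪_{Spec B}` as two modules on a
scheme without points, with `𝒪_{Spec B}` quasi-coherent of rank one. [cite: MumfordAV1970, §10 (p. 89)] -/
theorem trivOfSubsingleton (B : Type) [CommRing B] [Algebra Γ(W.left, U) B] [Subsingleton B] :
    SeesawRelative.Triv X 𝓕 U B := by
  haveI : IsEmpty (X ⊗ specTest U B).left := isEmpty_tensor_specTest X U B
  haveI : (unitModule (specTest U B).left).IsQuasicoherent :=
    isQuasicoherent_of_isAffineLocalizing IsAffineLocalizing.unit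
  exact ⟨unitModule (specTest U B).left, inferInstance, hasRank_unitModule,
    nonempty_iso_of_isEmpty _ _⟩

end SeesawRelative

end Literature.AlgebraicGeometry.Motives


namespace Literature.AlgebraicGeometry.Motives

namespace SeesawRelative

open Literature.AlgebraicGeometry.Modules

variable {R : Type} [CommRing R] (X : SchemeOver R) {W : SchemeOver R} (𝓕 : (X ⊗ W).left.Modules)
  (U : W.left.affineOpens)

variable [GeometricallyIntegral X.hom] (hSt : UnivStein X)
include hSt

/-! ## §4 The fibres over a field: sections and functionals form lines -/

omit hSt in
/-- On the integral fibre `X × Spec K`, a non-zero functional `μ ∈ Hom(𝓕_K|_⊤, 𝒪|_⊤)` kills no non-zero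
section (brick (B) on `X_K`, integral by geometric integrality of `X/R`). [cite: MumfordAV1970, §10 (p. 89)] -/
theorem evalPair_ne_zero_of_ne_zero (h𝓕 : HasRank 𝓕 1) (K : Type) [Field K]
    [Algebra Γ(W.left, U) K] (μ : SeesawRelative.DualSec X 𝓕 U K) (hμ : μ ≠ 0) (σ : H0 X 𝓕 U K) (hσ : σ ≠ 0) :
    evalPair X 𝓕 U K μ σ ≠ 0 := by
  haveI : IsIntegral (X ⊗ specTest U K).left := isIntegral_tensor_specTest X U K
  exact appLE_ne_zero_of_ne_zero (hasRank_FB X 𝓕 U h𝓕 K) hσ hμ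

/-- **`dim_K H⁰(X_K, 𝓕_K) = 1`** when both `H⁰(X_K, 𝓕_K) ≠ 0` and `Hom(𝓕_K|_⊤, 𝒪|_⊤) ≠ 0` (the point lies in
`Supp Q ∩ Supp Q′`); by ★ brick (B). [cite: MumfordAV1970, §10 (p. 89)] -/
theorem finrank_h0_eq_one (h𝓕 : HasRank 𝓕 1) (K : Type) [Field K]
    [Algebra Γ(W.left, U) K] (μ : SeesawRelative.DualSec X 𝓕 U K) (hμ : μ ≠ 0) (σ : H0 X 𝓕 U K) (hσ : σ ≠ 0) :
    Module.finrank K (H0 X 𝓕 U K) = 1 :=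
  finrank_eq_one_of_forall_ne_zero (toTopRing X U K) (toTopRing_bijective hSt K)
    (μ : (FB X 𝓕 U K).over ⊤ ⟶ (unitModule (X ⊗ specTest U K).left).over ⊤)
    (fun τ hτ => evalPair_ne_zero_of_ne_zero X 𝓕 U h𝓕 K μ hμ τ hτ) σ hσ

/-- **`dim_K Hom(𝓕_K|_⊤, 𝒪|_⊤) = 1`** when both a non-zero section and a non-zero functional exist; by ★ brick (B).
[cite: MumfordAV1970, §10 (p. 89)] -/
theorem finrank_dualSec_eq_one (h𝓕 : HasRank 𝓕 1) (K : Type) [Field K]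
    [Algebra Γ(W.left, U) K] (σ : SeesawRelative.H0 X 𝓕 U K) (hσ : σ ≠ 0) (μ : DualSec X 𝓕 U K) (hμ : μ ≠ 0) :
    Module.finrank K (DualSec X 𝓕 U K) = 1 :=
  finrank_dual_eq_one_of_forall_ne_zero (E := FB X 𝓕 U K) (toTopRing X U K) (toTopRing_bijective hSt K) σ
    (fun ν hν => evalPair_ne_zero_of_ne_zero X 𝓕 U h𝓕 K ν hν σ hσ) μ hμ

/-- **`H⁰(X_K, 𝓕_K)` is a line through any non-zero section** as soon as `Hom(𝓕_K|_⊤, 𝒪|_⊤) ≠ 0` (first half of the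
fibre statement `fibreCyclic` of the chart step). [cite: MumfordAV1970, §10 (p. 89)] -/
theorem h0_cyclic_of_dualSec_ne_zero (h𝓕 : HasRank 𝓕 1) (K : Type) [Field K] [Algebra Γ(W.left, U) K]
    (hμ : ∃ μ : SeesawRelative.DualSec X 𝓕 U K, μ ≠ 0) (σ₁ σ₂ : H0 X 𝓕 U K) (hσ₁ : σ₁ ≠ 0) : ∃ c : K, σ₂ = c • σ₁ := by
  obtain ⟨μ, hμ⟩ := hμ
  have h1 : Module.finrank K (H0 X 𝓕 U K) = 1 := finrank_h0_eq_one X 𝓕 U hSt h𝓕 K μ hμ σ₁ hσ₁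
  obtain ⟨c, hc⟩ := (finrank_eq_one_iff_of_nonzero' σ₁ hσ₁).1 h1 σ₂
  exact ⟨c, hc.symm⟩

/-- **`Hom(𝓕_K|_⊤, 𝒪|_⊤)` is a line through any non-zero functional** as soon as `H⁰(X_K, 𝓕_K) ≠ 0` (second half of
`fibreCyclic`). [cite: MumfordAV1970, §10 (p. 89)] -/
theorem dualSec_cyclic_of_h0_ne_zero (h𝓕 : HasRank 𝓕 1) (K : Type) [Field K] [Algebra Γ(W.left, U) K]
    (hσ : ∃ σ : SeesawRelative.H0 X 𝓕 U K, σ ≠ 0) (μ₁ μ₂ : DualSec X 𝓕 U K) (hμ₁ : μ₁ ≠ 0) : ∃ c : K, μ₂ = c • μ₁ := by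
  obtain ⟨σ, hσ⟩ := hσ
  have h1 : Module.finrank K (DualSec X 𝓕 U K) = 1 := finrank_dualSec_eq_one X 𝓕 U hSt h𝓕 K σ hσ μ₁ hμ₁
  obtain ⟨c, hc⟩ := (finrank_eq_one_iff_of_nonzero' μ₁ hμ₁).1 h1 μ₂
  exact ⟨c, hc.symm⟩

end SeesawRelative

end Literature.AlgebraicGeometry.Motives

/-! ## §5 Base change of the evaluation pairing (`brickN`) over ★ `Modules.DualSectionsEquiv` -/

namespace Literature.AlgebraicGeometry.Motives

namespace SeesawRelative

open Literature.AlgebraicGeometry.Modules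

variable {R : Type} [CommRing R] (X : SchemeOver R) {W : SchemeOver R} (𝓕 : (X ⊗ W).left.Modules)
  (U : W.left.affineOpens)



/-- **Brick (N) holds**: the evaluation pairing commutes with base change along a chart algebra map
`φ : B → C` — `μ_C(σ_C) = (1 × Spec φ)♯(μ_B(σ_B))` ([Hartshorne1977] II Ex. 5.1 (d): `f^*` is compatible with `𝓗om`/duals;
B-typ03's brick (C) core + the `FBIso` cancellation; `H0map`/`DualSecMap`/`evalPair` are unfolded through their `rfl`
equations in unapplied form, which keeps the kernel on B-p01's own terms). [cite: Hartshorne1977, II Ex. 5.1 (d)]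
[cite: MumfordAV1970, §10 (p. 89)] -/
theorem evalPair_baseChange (h𝓕 : HasRank 𝓕 1) : SeesawRelative.brickN X 𝓕 U h𝓕 := by
  intro B C _ _ _ _ φ σ μ
  have hH : H0map X 𝓕 U φ = fun s =>
      ((FBIso X 𝓕 U φ).hom.app ⊤) (unitSection (X ◁ specTestMap U φ).left (FB X 𝓕 U B) ⊤ s) := rfl
  have hD : DualSecMap X 𝓕 U h𝓕 φ = fun μ =>
      ((sheafHomMapLeft (FBIso X 𝓕 U φ).inv (unitModule (X ⊗ specTest U C).left)).app ⊤)
        (((pullbackDualIso (X ◁ specTestMap U φ).left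
          (HasRank.isFiniteLocallyFree' (hasRank_FB X 𝓕 U h𝓕 B))).hom.app ⊤)
            (unitSection (X ◁ specTestMap U φ).left (Modules.dual (FB X 𝓕 U B)) ⊤ μ)) := rfl
  have hEC : evalPair X 𝓕 U C = fun μ σ =>
      (appLE (μ : (FB X 𝓕 U C).over ⊤ ⟶ (unitModule (X ⊗ specTest U C).left).over ⊤) (𝟙 ⊤) σ :
        Γ(unitModule (X ⊗ specTest U C).left, (⊤ : (X ⊗ specTest U C).left.Opens))) := rfl
  have hEB : evalPair X 𝓕 U B = fun μ σ =>
      (appLE (μ : (FB X 𝓕 U B).over ⊤ ⟶ (unitModule (X ⊗ specTest U B).left).over ⊤) (𝟙 ⊤) σ :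
        Γ(unitModule (X ⊗ specTest U B).left, (⊤ : (X ⊗ specTest U B).left.Opens))) := rfl
  rw [hH, hD, hEC, hEB]
  exact SeesawSubscheme.appLE_sheafHomMapLeft_pullbackDualIso_unitSection (X ◁ specTestMap U φ).left
    (HasRank.isFiniteLocallyFree' (hasRank_FB X 𝓕 U h𝓕 B)) (FBIso X 𝓕 U φ) μ σ

end SeesawRelative

end Literature.AlgebraicGeometry.Motives

end
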